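import Mathlib
import Literature.Analysis.FluidPDE.Tao2016AveragedNS.CascadeTableDictionary
import Literature.Analysis.FluidPDE.Tao2016AveragedNS.LocalCascadeSolutions
import HarnessLib

/-!
# The MIXED-DRAIN TWIN-FED PAIR `M(u,v)`: the (self, cross) drain type of the blow-up-pair normal form
  (`…ExtinguishableCore`, `pair_normalForm_of_noGlobalCascade`), displayed with its EXACT shell law — the smallest
  fixed-spread table family on which the rung leaf of route TaoLadderRungTwoBreak is neither vacuous (the pair `{0,1}` is a
  PERPETUAL core, `…PerpetualCore`) nor the dyadic member's question (no invariant ray, unlike `…SelfDrainPair`): census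
  item (MP) of hand 7-g31 for K2(1) `TaoLadderRungTwoBreak.BlowupRigidityOne` (stmt-NavierStokesRegularity-20206; `--supports`)

MODEL lattice ODEs only (Tao 2016 §4 (4.1)–(4.3), Lemma 4.1 (4.8), Thm. 4.2 statement shape); nothing here is a statement about
the Navier–Stokes equations; NO item is closed.  DEF-FREE (the table is a lambda displayed in every statement);
ROUTE-INDEPENDENT MODULE (no `Theses` import).  Nothing is claimed about the blow-up of `M(u,v)`.

THE TABLE `M(u,v)` (modes `a = 0`, `b = 1`; modes `2, 3` idle).  Cross feeds `α_{01 0,(0,0,1)} = α_{10 0,(0,0,1)} = u`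
(`x_0 x_1 ↦ y_0`), `α_{01 1,(0,0,1)} = α_{10 1,(0,0,1)} = v` (`x_0 x_1 ↦ y_1`); the feed into `y_0` drains ITS OWN twin below
(`α_{10 0,(0,1,0)} = α_{01 0,(1,0,0)} = −u`: `x_1 y_0 ↦ x_0`), the feed into `y_1` drains the OTHER twin
(`α_{11 0,(0,1,0)} = α_{11 0,(1,0,0)} = −v`: `x_1 y_1 ↦ x_0`); everything else `0`.  Symmetric, cancelling (orbits `0 + u − u`,
`0 + v − v`), in `E₂(R)` as soon as `R⁻¹ ≤ |u|, |v| ≤ 1`.  The mirror type (cross, self) is `M` with the modes swapped.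

THE EXACT LAW (`quadTerm_mixedDrainPair`, any mode family `X`; `Λ_k = (1+ε₀)^{5k/2}`, `a = X_0`, `b = X_1`):
  `quadTerm_{0,n} = 2u Λ_{n−1} a_{n−1} b_{n−1} − 2 Λ_n b_n (u a_{n+1} + v b_{n+1})`,
  `quadTerm_{1,n} = 2v Λ_{n−1} a_{n−1} b_{n−1}`,   `quadTerm_{2,n} = quadTerm_{3,n} = 0`:
mode `b` is fed and NEVER drained from above, mode `a` pays the whole flux `2Λ_n a_n b_n (u a_{n+1} + v b_{n+1})` into shell
`n+1` — a two-component ladder with a built-in wake (whatever `b_n` holds when shell `n−1` goes quiet stays in shell `n`), but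
with NO sign structure (the drain on `a_n` is not proportional to `a_n`).  `mixedDrainPair_perpetualCore`: `{0,1}` admits no
internal support chain to `∅` (both feeds live), so none of the support-only normal forms settles `M(u,v)`; and no ray
`(a,b) = (αX, βX)` maps dyadic solutions to solutions (`ḃ` has no drain).  Deciding `NoGlobalCascade ε₀ M(u,v) X₀` at small
`ε₀` is the census item (MP): analytic / numerics, not combinatorics.

HONEST LABEL: a certified problem statement (table, class membership, exact law, perpetuality) for the next seat; no stub,
crux, rung or summit is proved; rung 0.
-/

noncomputable section

-- the summit and its single sub-problem share the name (CONVENTIONS §1)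
set_option linter.dupNamespace false

open Set

namespace Summit.NavierStokesRegularity.NavierStokesRegularity.Theorems

namespace BlowupRigidityOne

open Literature.Analysis.FluidPDE Literature.Analysis.FluidPDE.TaoCascade

/-! ## The table `M(u,v)` -/

/-- `M(u,v)` is symmetric (4.2). [cite: Tao2016AveragedNS, §4 (4.2); cell vocabulary (`IsSymmetricCoeff`)] -/
theorem isSymmetricCoeff_mixedDrainPair (u v : ℝ) :
    IsSymmetricCoeff (fun (i₁ i₂ i₃ : Fin 4) (μ : ℤ × ℤ × ℤ) => if μ = ((0 : ℤ), (0 : ℤ), (1 : ℤ)) then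
        (if (i₁ = 0 ∧ i₂ = 1) ∨ (i₁ = 1 ∧ i₂ = 0) then (if i₃ = 0 then u else if i₃ = 1 then v else 0) else 0)
      else if μ = ((1 : ℤ), (0 : ℤ), (0 : ℤ)) then
        (if i₁ = 0 ∧ i₂ = 1 ∧ i₃ = 0 then -u else if i₁ = 1 ∧ i₂ = 1 ∧ i₃ = 0 then -v else 0)
      else if μ = ((0 : ℤ), (1 : ℤ), (0 : ℤ)) then
        (if i₁ = 1 ∧ i₂ = 0 ∧ i₃ = 0 then -u else if i₁ = 1 ∧ i₂ = 1 ∧ i₃ = 0 then -v else 0) else 0) := by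
  intro i₁ i₂ i₃ μ₁ μ₂ μ₃ hμ
  rw [mem_shiftSet_iff] at hμ
  simp only [Prod.mk.injEq] at hμ
  rcases hμ with ⟨rfl, rfl, rfl⟩ | ⟨rfl, rfl, rfl⟩ | ⟨rfl, rfl, rfl⟩ | ⟨rfl, rfl, rfl⟩ <;>
    fin_cases i₁ <;> fin_cases i₂ <;> fin_cases i₃ <;> norm_num

/-- `M(u,v)` is cancelling (4.3). [cite: Tao2016AveragedNS, §4 (4.3); cell vocabulary (`IsCancellingCoeff`)] -/
theorem isCancellingCoeff_mixedDrainPair (u v : ℝ) :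
    IsCancellingCoeff (fun (i₁ i₂ i₃ : Fin 4) (μ : ℤ × ℤ × ℤ) => if μ = ((0 : ℤ), (0 : ℤ), (1 : ℤ)) then
        (if (i₁ = 0 ∧ i₂ = 1) ∨ (i₁ = 1 ∧ i₂ = 0) then (if i₃ = 0 then u else if i₃ = 1 then v else 0) else 0)
      else if μ = ((1 : ℤ), (0 : ℤ), (0 : ℤ)) then
        (if i₁ = 0 ∧ i₂ = 1 ∧ i₃ = 0 then -u else if i₁ = 1 ∧ i₂ = 1 ∧ i₃ = 0 then -v else 0)
      else if μ = ((0 : ℤ), (1 : ℤ), (0 : ℤ)) then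
        (if i₁ = 1 ∧ i₂ = 0 ∧ i₃ = 0 then -u else if i₁ = 1 ∧ i₂ = 1 ∧ i₃ = 0 then -v else 0) else 0) := by
  intro i₁ i₂ i₃ μ₁ μ₂ μ₃ hμ
  rw [mem_shiftSet_iff] at hμ
  simp only [Prod.mk.injEq] at hμ
  rcases hμ with ⟨rfl, rfl, rfl⟩ | ⟨rfl, rfl, rfl⟩ | ⟨rfl, rfl, rfl⟩ | ⟨rfl, rfl, rfl⟩ <;>
    fin_cases i₁ <;> fin_cases i₂ <;> fin_cases i₃ <;> norm_num

/-- Every entry of `M(u,v)` is one of `0, u, v, −u, −v`. [cite: Tao2016AveragedNS, §4 (4.1); cell vocabulary] -/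
theorem mixedDrainPair_values (u v : ℝ) (i₁ i₂ i₃ : Fin 4) (μ : ℤ × ℤ × ℤ) :
    (fun (i₁ i₂ i₃ : Fin 4) (μ : ℤ × ℤ × ℤ) => if μ = ((0 : ℤ), (0 : ℤ), (1 : ℤ)) then
        (if (i₁ = 0 ∧ i₂ = 1) ∨ (i₁ = 1 ∧ i₂ = 0) then (if i₃ = 0 then u else if i₃ = 1 then v else 0) else 0)
      else if μ = ((1 : ℤ), (0 : ℤ), (0 : ℤ)) then
        (if i₁ = 0 ∧ i₂ = 1 ∧ i₃ = 0 then -u else if i₁ = 1 ∧ i₂ = 1 ∧ i₃ = 0 then -v else 0)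
      else if μ = ((0 : ℤ), (1 : ℤ), (0 : ℤ)) then
        (if i₁ = 1 ∧ i₂ = 0 ∧ i₃ = 0 then -u else if i₁ = 1 ∧ i₂ = 1 ∧ i₃ = 0 then -v else 0) else 0) i₁ i₂ i₃ μ ∈ ({0, u, v, -u, -v} : Set ℝ) := by
  dsimp only
  split_ifs <;> simp

/-- **`M(u,v) ∈ E₂(R)` whenever `R⁻¹ ≤ |u| ≤ 1` and `R⁻¹ ≤ |v| ≤ 1`.**
[cite: Tao2016AveragedNS, §4 (4.2)–(4.3), §6.1; cell vocabulary (`InTableClass`)] -/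
theorem inTableClass_mixedDrainPair {R u v : ℝ} (hu : R⁻¹ ≤ |u|) (hu1 : |u| ≤ 1) (hv : R⁻¹ ≤ |v|)
    (hv1 : |v| ≤ 1) : InTableClass R (fun (i₁ i₂ i₃ : Fin 4) (μ : ℤ × ℤ × ℤ) => if μ = ((0 : ℤ), (0 : ℤ), (1 : ℤ)) then
        (if (i₁ = 0 ∧ i₂ = 1) ∨ (i₁ = 1 ∧ i₂ = 0) then (if i₃ = 0 then u else if i₃ = 1 then v else 0) else 0)
      else if μ = ((1 : ℤ), (0 : ℤ), (0 : ℤ)) then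
        (if i₁ = 0 ∧ i₂ = 1 ∧ i₃ = 0 then -u else if i₁ = 1 ∧ i₂ = 1 ∧ i₃ = 0 then -v else 0)
      else if μ = ((0 : ℤ), (1 : ℤ), (0 : ℤ)) then
        (if i₁ = 1 ∧ i₂ = 0 ∧ i₃ = 0 then -u else if i₁ = 1 ∧ i₂ = 1 ∧ i₃ = 0 then -v else 0) else 0) := by
  refine ⟨isSymmetricCoeff_mixedDrainPair u v, isCancellingCoeff_mixedDrainPair u v, fun i₁ i₂ i₃ μ _ => ?_⟩
  have hval := mixedDrainPair_values u v i₁ i₂ i₃ μ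
  dsimp only at hval ⊢
  simp only [Set.mem_insert_iff, Set.mem_singleton_iff] at hval
  rcases hval with h | h | h | h | h <;> rw [h]
  · simp
  · exact ⟨hu1, Or.inr hu⟩
  · exact ⟨hv1, Or.inr hv⟩
  · exact ⟨by rw [abs_neg]; exact hu1, Or.inr (by rw [abs_neg]; exact hu)⟩
  · exact ⟨by rw [abs_neg]; exact hv1, Or.inr (by rw [abs_neg]; exact hv)⟩

/-! ## The structure maps and the exact law -/

/-- Cross feed of `M(u,v)`: `(Σ α_{i₁i₂i,(0,0,1)} x_{i₁} y_{i₂})_i = (u, v, 0, 0)_i · (x_0 y_1 + x_1 y_0)`.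
[cite: Tao2016AveragedNS, §4 (4.1), Lemma 4.1 (4.8); cell vocabulary (`qform`)] -/
theorem qform_mixedDrainPair_feed (u v : ℝ) (x y : Em 4) (i : Fin 4) :
    qform (fun (i₁ i₂ i₃ : Fin 4) (μ : ℤ × ℤ × ℤ) => if μ = ((0 : ℤ), (0 : ℤ), (1 : ℤ)) then
        (if (i₁ = 0 ∧ i₂ = 1) ∨ (i₁ = 1 ∧ i₂ = 0) then (if i₃ = 0 then u else if i₃ = 1 then v else 0) else 0)
      else if μ = ((1 : ℤ), (0 : ℤ), (0 : ℤ)) then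
        (if i₁ = 0 ∧ i₂ = 1 ∧ i₃ = 0 then -u else if i₁ = 1 ∧ i₂ = 1 ∧ i₃ = 0 then -v else 0)
      else if μ = ((0 : ℤ), (1 : ℤ), (0 : ℤ)) then
        (if i₁ = 1 ∧ i₂ = 0 ∧ i₃ = 0 then -u else if i₁ = 1 ∧ i₂ = 1 ∧ i₃ = 0 then -v else 0) else 0) (0, 0, 1) x y i =
      (if i = 0 then u else if i = 1 then v else 0) * (x 0 * y 1 + x 1 * y 0) := by
  unfold qform
  fin_cases i <;> simp [Fin.sum_univ_four] <;> ring

/-- `(1,0,0)` drains of `M(u,v)` (shell above holds `y`, shell below `x`): only mode `0` is drained,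
`−(u y_0 + v y_1) x_1`. [cite: Tao2016AveragedNS, §4 (4.1), Lemma 4.1 (4.8); cell vocabulary (`qform`)] -/
theorem qform_mixedDrainPair_back₁ (u v : ℝ) (y x : Em 4) (i : Fin 4) :
    qform (fun (i₁ i₂ i₃ : Fin 4) (μ : ℤ × ℤ × ℤ) => if μ = ((0 : ℤ), (0 : ℤ), (1 : ℤ)) then
        (if (i₁ = 0 ∧ i₂ = 1) ∨ (i₁ = 1 ∧ i₂ = 0) then (if i₃ = 0 then u else if i₃ = 1 then v else 0) else 0)
      else if μ = ((1 : ℤ), (0 : ℤ), (0 : ℤ)) then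
        (if i₁ = 0 ∧ i₂ = 1 ∧ i₃ = 0 then -u else if i₁ = 1 ∧ i₂ = 1 ∧ i₃ = 0 then -v else 0)
      else if μ = ((0 : ℤ), (1 : ℤ), (0 : ℤ)) then
        (if i₁ = 1 ∧ i₂ = 0 ∧ i₃ = 0 then -u else if i₁ = 1 ∧ i₂ = 1 ∧ i₃ = 0 then -v else 0) else 0) (1, 0, 0) y x i = if i = 0 then -((u * y 0 + v * y 1) * x 1) else 0 := by
  unfold qform
  fin_cases i <;> simp [Fin.sum_univ_four]
  ring

/-- `(0,1,0)` drains of `M(u,v)` (shell below holds `x`, shell above `y`): only mode `0`, `−(u y_0 + v y_1) x_1`.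
[cite: Tao2016AveragedNS, §4 (4.1), Lemma 4.1 (4.8); cell vocabulary (`qform`)] -/
theorem qform_mixedDrainPair_back₂ (u v : ℝ) (y x : Em 4) (i : Fin 4) :
    qform (fun (i₁ i₂ i₃ : Fin 4) (μ : ℤ × ℤ × ℤ) => if μ = ((0 : ℤ), (0 : ℤ), (1 : ℤ)) then
        (if (i₁ = 0 ∧ i₂ = 1) ∨ (i₁ = 1 ∧ i₂ = 0) then (if i₃ = 0 then u else if i₃ = 1 then v else 0) else 0)
      else if μ = ((1 : ℤ), (0 : ℤ), (0 : ℤ)) then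
        (if i₁ = 0 ∧ i₂ = 1 ∧ i₃ = 0 then -u else if i₁ = 1 ∧ i₂ = 1 ∧ i₃ = 0 then -v else 0)
      else if μ = ((0 : ℤ), (1 : ℤ), (0 : ℤ)) then
        (if i₁ = 1 ∧ i₂ = 0 ∧ i₃ = 0 then -u else if i₁ = 1 ∧ i₂ = 1 ∧ i₃ = 0 then -v else 0) else 0) (0, 1, 0) x y i = if i = 0 then -((u * y 0 + v * y 1) * x 1) else 0 := by
  unfold qform
  fin_cases i <;> simp [Fin.sum_univ_four]
  ring

/-- `M(u,v)` has no intra-shell block. [cite: Tao2016AveragedNS, §4 (4.1); cell vocabulary (`qform`)] -/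
theorem qform_mixedDrainPair_intra (u v : ℝ) (x y : Em 4) (i : Fin 4) :
    qform (fun (i₁ i₂ i₃ : Fin 4) (μ : ℤ × ℤ × ℤ) => if μ = ((0 : ℤ), (0 : ℤ), (1 : ℤ)) then
        (if (i₁ = 0 ∧ i₂ = 1) ∨ (i₁ = 1 ∧ i₂ = 0) then (if i₃ = 0 then u else if i₃ = 1 then v else 0) else 0)
      else if μ = ((1 : ℤ), (0 : ℤ), (0 : ℤ)) then
        (if i₁ = 0 ∧ i₂ = 1 ∧ i₃ = 0 then -u else if i₁ = 1 ∧ i₂ = 1 ∧ i₃ = 0 then -v else 0)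
      else if μ = ((0 : ℤ), (1 : ℤ), (0 : ℤ)) then
        (if i₁ = 1 ∧ i₂ = 0 ∧ i₃ = 0 then -u else if i₁ = 1 ∧ i₂ = 1 ∧ i₃ = 0 then -v else 0) else 0) (0, 0, 0) x y i = 0 := by
  unfold qform
  fin_cases i <;> simp

/-- **THE EXACT SHELL LAW OF `M(u,v)`** for an arbitrary mode family `X` (`a = X_0`, `b = X_1`; `Λ_k = (1+ε₀)^{5k/2}`):
`quadTerm_{0,n} = Λ_{n−1}·2u a_{n−1}b_{n−1} − Λ_n·2 b_n (u a_{n+1} + v b_{n+1})`, `quadTerm_{1,n} = Λ_{n−1}·2v a_{n−1}b_{n−1}`,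
`quadTerm_{2,n} = quadTerm_{3,n} = 0` — mode `1` is never drained from above; mode `0` carries both drains.
[cite: Tao2016AveragedNS, §4 (4.1), Lemma 4.1 (4.8); tree `quadTerm_eq_tables`] -/
theorem quadTerm_mixedDrainPair (u v ε₀ : ℝ) (X : Fin 4 → ℤ → ℝ → ℝ) (i : Fin 4) (n : ℤ) (t : ℝ) :
    quadTerm ε₀ (fun (i₁ i₂ i₃ : Fin 4) (μ : ℤ × ℤ × ℤ) => if μ = ((0 : ℤ), (0 : ℤ), (1 : ℤ)) then
        (if (i₁ = 0 ∧ i₂ = 1) ∨ (i₁ = 1 ∧ i₂ = 0) then (if i₃ = 0 then u else if i₃ = 1 then v else 0) else 0)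
      else if μ = ((1 : ℤ), (0 : ℤ), (0 : ℤ)) then
        (if i₁ = 0 ∧ i₂ = 1 ∧ i₃ = 0 then -u else if i₁ = 1 ∧ i₂ = 1 ∧ i₃ = 0 then -v else 0)
      else if μ = ((0 : ℤ), (1 : ℤ), (0 : ℤ)) then
        (if i₁ = 1 ∧ i₂ = 0 ∧ i₃ = 0 then -u else if i₁ = 1 ∧ i₂ = 1 ∧ i₃ = 0 then -v else 0) else 0) X i n t =
      if i = 0 then
        (1 + ε₀) ^ ((5 : ℝ) * ((n : ℝ) - 1) / 2) * (2 * u * (X 0 (n - 1) t * X 1 (n - 1) t)) -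
          (1 + ε₀) ^ ((5 : ℝ) * n / 2) * (2 * X 1 n t * (u * X 0 (n + 1) t + v * X 1 (n + 1) t))
      else if i = 1 then (1 + ε₀) ^ ((5 : ℝ) * ((n : ℝ) - 1) / 2) * (2 * v * (X 0 (n - 1) t * X 1 (n - 1) t))
      else 0 := by
  rw [quadTerm_eq_tables, tableQ_apply, tableA_apply, tableB_apply, qform_mixedDrainPair_intra, qform_mixedDrainPair_feed,
    qform_mixedDrainPair_back₁, qform_mixedDrainPair_back₂]
  simp only [shellVec_apply]
  split_ifs <;> ring

/-! ## `{0, 1}` is a perpetual core of `M(u,v)` -/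

/-- **`M(u,v)` HAS THE PERPETUAL CORE `{0,1}`** (`u, v ≠ 0`): both twins are fed by `x_0 x_1`, so condition (O) forces every
level of an internal support chain starting at `{0,1}` to contain both, and no level is empty — the hypothesis shape of
`blowupRigidityOne_iff_perpetualCore` / `target_iff_perpetualCore`: none of the support-only normal forms settles `M(u,v)`.
[cite: Tao2016AveragedNS, §4 (4.1); cell vocabulary (perpetual core, internal support chain)] -/
theorem mixedDrainPair_perpetualCore {u v : ℝ} (hu : u ≠ 0) (hv : v ≠ 0) :
    ∃ C : Finset (Fin 4), (∀ i ∈ C, ∃ μ ∈ shiftSet, ∃ j ∈ C, ∃ k ∈ C, (fun (i₁ i₂ i₃ : Fin 4) (μ : ℤ × ℤ × ℤ) => if μ = ((0 : ℤ), (0 : ℤ), (1 : ℤ)) then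
        (if (i₁ = 0 ∧ i₂ = 1) ∨ (i₁ = 1 ∧ i₂ = 0) then (if i₃ = 0 then u else if i₃ = 1 then v else 0) else 0)
      else if μ = ((1 : ℤ), (0 : ℤ), (0 : ℤ)) then
        (if i₁ = 0 ∧ i₂ = 1 ∧ i₃ = 0 then -u else if i₁ = 1 ∧ i₂ = 1 ∧ i₃ = 0 then -v else 0)
      else if μ = ((0 : ℤ), (1 : ℤ), (0 : ℤ)) then
        (if i₁ = 1 ∧ i₂ = 0 ∧ i₃ = 0 then -u else if i₁ = 1 ∧ i₂ = 1 ∧ i₃ = 0 then -v else 0) else 0) j k i μ ≠ 0) ∧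
      ¬ ∃ (L : ℕ) (E : ℕ → Finset (Fin 4)), E 0 = C ∧ E (L + 1) = ∅ ∧ (∀ l, E l ⊆ C) ∧
        (∀ l j k i, j ∈ E l → k ∈ E l → i ∈ C → i ∉ E (l + 1) →
          (fun (i₁ i₂ i₃ : Fin 4) (μ : ℤ × ℤ × ℤ) => if μ = ((0 : ℤ), (0 : ℤ), (1 : ℤ)) then
        (if (i₁ = 0 ∧ i₂ = 1) ∨ (i₁ = 1 ∧ i₂ = 0) then (if i₃ = 0 then u else if i₃ = 1 then v else 0) else 0)
      else if μ = ((1 : ℤ), (0 : ℤ), (0 : ℤ)) then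
        (if i₁ = 0 ∧ i₂ = 1 ∧ i₃ = 0 then -u else if i₁ = 1 ∧ i₂ = 1 ∧ i₃ = 0 then -v else 0)
      else if μ = ((0 : ℤ), (1 : ℤ), (0 : ℤ)) then
        (if i₁ = 1 ∧ i₂ = 0 ∧ i₃ = 0 then -u else if i₁ = 1 ∧ i₂ = 1 ∧ i₃ = 0 then -v else 0) else 0) j k i ((0 : ℤ), (0 : ℤ), (1 : ℤ)) = 0) ∧
        (∀ l j k i, j ∈ E l → k ∈ E l → i ∈ C → i ∉ E l →
          (fun (i₁ i₂ i₃ : Fin 4) (μ : ℤ × ℤ × ℤ) => if μ = ((0 : ℤ), (0 : ℤ), (1 : ℤ)) then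
        (if (i₁ = 0 ∧ i₂ = 1) ∨ (i₁ = 1 ∧ i₂ = 0) then (if i₃ = 0 then u else if i₃ = 1 then v else 0) else 0)
      else if μ = ((1 : ℤ), (0 : ℤ), (0 : ℤ)) then
        (if i₁ = 0 ∧ i₂ = 1 ∧ i₃ = 0 then -u else if i₁ = 1 ∧ i₂ = 1 ∧ i₃ = 0 then -v else 0)
      else if μ = ((0 : ℤ), (1 : ℤ), (0 : ℤ)) then
        (if i₁ = 1 ∧ i₂ = 0 ∧ i₃ = 0 then -u else if i₁ = 1 ∧ i₂ = 1 ∧ i₃ = 0 then -v else 0) else 0) j k i ((0 : ℤ), (0 : ℤ), (0 : ℤ)) = 0) ∧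
        (∀ l j k i, j ∈ E (l + 1) → k ∈ E l → i ∈ C → i ∉ E l →
          (fun (i₁ i₂ i₃ : Fin 4) (μ : ℤ × ℤ × ℤ) => if μ = ((0 : ℤ), (0 : ℤ), (1 : ℤ)) then
        (if (i₁ = 0 ∧ i₂ = 1) ∨ (i₁ = 1 ∧ i₂ = 0) then (if i₃ = 0 then u else if i₃ = 1 then v else 0) else 0)
      else if μ = ((1 : ℤ), (0 : ℤ), (0 : ℤ)) then
        (if i₁ = 0 ∧ i₂ = 1 ∧ i₃ = 0 then -u else if i₁ = 1 ∧ i₂ = 1 ∧ i₃ = 0 then -v else 0)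
      else if μ = ((0 : ℤ), (1 : ℤ), (0 : ℤ)) then
        (if i₁ = 1 ∧ i₂ = 0 ∧ i₃ = 0 then -u else if i₁ = 1 ∧ i₂ = 1 ∧ i₃ = 0 then -v else 0) else 0) j k i ((1 : ℤ), (0 : ℤ), (0 : ℤ)) = 0 ∧ (fun (i₁ i₂ i₃ : Fin 4) (μ : ℤ × ℤ × ℤ) => if μ = ((0 : ℤ), (0 : ℤ), (1 : ℤ)) then
        (if (i₁ = 0 ∧ i₂ = 1) ∨ (i₁ = 1 ∧ i₂ = 0) then (if i₃ = 0 then u else if i₃ = 1 then v else 0) else 0)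
      else if μ = ((1 : ℤ), (0 : ℤ), (0 : ℤ)) then
        (if i₁ = 0 ∧ i₂ = 1 ∧ i₃ = 0 then -u else if i₁ = 1 ∧ i₂ = 1 ∧ i₃ = 0 then -v else 0)
      else if μ = ((0 : ℤ), (1 : ℤ), (0 : ℤ)) then
        (if i₁ = 1 ∧ i₂ = 0 ∧ i₃ = 0 then -u else if i₁ = 1 ∧ i₂ = 1 ∧ i₃ = 0 then -v else 0) else 0) k j i ((0 : ℤ), (1 : ℤ), (0 : ℤ)) = 0) := by
  classical
  have h001 : ((0 : ℤ), (0 : ℤ), (1 : ℤ)) ∈ shiftSet := by simp [shiftSet]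
  -- the two live cross feeds
  have hfeed : ∀ i : Fin 4, i ∈ ({0, 1} : Finset (Fin 4)) →
      (fun (i₁ i₂ i₃ : Fin 4) (μ : ℤ × ℤ × ℤ) => if μ = ((0 : ℤ), (0 : ℤ), (1 : ℤ)) then
        (if (i₁ = 0 ∧ i₂ = 1) ∨ (i₁ = 1 ∧ i₂ = 0) then (if i₃ = 0 then u else if i₃ = 1 then v else 0) else 0)
      else if μ = ((1 : ℤ), (0 : ℤ), (0 : ℤ)) then
        (if i₁ = 0 ∧ i₂ = 1 ∧ i₃ = 0 then -u else if i₁ = 1 ∧ i₂ = 1 ∧ i₃ = 0 then -v else 0)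
      else if μ = ((0 : ℤ), (1 : ℤ), (0 : ℤ)) then
        (if i₁ = 1 ∧ i₂ = 0 ∧ i₃ = 0 then -u else if i₁ = 1 ∧ i₂ = 1 ∧ i₃ = 0 then -v else 0) else 0) 0 1 i ((0 : ℤ), (0 : ℤ), (1 : ℤ)) ≠ 0 := by
    intro i hi
    rw [Finset.mem_insert, Finset.mem_singleton] at hi
    rcases hi with rfl | rfl
    · simpa using hu
    · simpa using hv
  have h0 : (0 : Fin 4) ∈ ({0, 1} : Finset (Fin 4)) := by simp
  have h1 : (1 : Fin 4) ∈ ({0, 1} : Finset (Fin 4)) := by simp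
  refine ⟨{0, 1}, fun i hi => ⟨_, h001, 0, h0, 1, h1, hfeed i hi⟩, ?_⟩
  rintro ⟨L, E, hE0, hEL, hEC, hOi, -, -⟩
  have hall : ∀ l, E l = ({0, 1} : Finset (Fin 4)) := by
    intro l
    induction l with
    | zero => exact hE0
    | succ l ih =>
        refine le_antisymm (hEC (l + 1)) ?_
        intro i hi
        by_contra hmem
        exact hfeed i hi (hOi l 0 1 i (by rw [ih]; exact h0) (by rw [ih]; exact h1) hi hmem)
  have h := hall (L + 1)
  rw [hEL] at h
  exact absurd (h ▸ h0 : (0 : Fin 4) ∈ (∅ : Finset (Fin 4))) (Finset.notMem_empty _)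

end BlowupRigidityOne

end Summit.NavierStokesRegularity.NavierStokesRegularity.Theorems

end
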